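import Literature.Analysis.FluidPDE.Seregin2020ScaledEnergyBoundsA
import Literature.Analysis.FluidPDE.SereginSverakIteration
import HarnessLib

/-!
# Scaled energies bounded from cubic absorption (ball form): the iteration of Seregin–Šverák 2009 Lemma 3.5 for a general suitable weak solution

G. Seregin, V. Šverák, *On Type I singularities of the local axi-symmetric solutions of the
Navier–Stokes equations*, Comm. PDE 34 (2009), 171–201 = arXiv:0804.1803, Lemma 3.5 and its
proof (arXiv pp. 9–10): once the cubic quantity is ABSORBED by the energy quantities,
(as11) `C(r) ≤ ε (E(r) + A(r)) + f₁(ε)` for every `ε > 0`, the local energy inequality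
(as12) `E(r/2) + A(r/2) ≤ c (C^{2/3} + C + D)(r)` and the decay estimate for the pressure
(as13) `D(ϱ) ≤ c [(ϱ/r) D(r) + (r/ϱ)² C(r)]` make `ℰ = E + A + D` satisfy
`ℰ(ϑ r) ≤ ½ ℰ(r) + f₃` for suitable `ϑ`, then `ε`, and the iteration ("The rest of the proof is
routine", p. 10) bounds `A + E + C + D` at all small radii. This is also the content of
G. Seregin, *Lecture Notes on Regularity Theory for the Navier–Stokes Equations* (2014),
Prop. 3.11 (i) (with Lemmas 6.2–6.4), for a GENERAL suitable weak solution.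

This file proves exactly that implication, in the tree's vocabulary of BALL cylinders
`parabolicCylinder r z = ]t - r², t[ × B(x, r)` at ONE fixed vertex `z = (t, x)` and the scaled
quantities `cknAEss` (`A`), `cknE` (`E`), `cknC` (`C`), `cknD` (`D`):

* `scaledEnergies_bounded_of_cubicAbsorption` — for a suitable weak solution `(u, p)` of the
  unforced unit-viscosity Navier–Stokes equations on an open `Q ⊇ Q_{r₀}(z)` with a weak spatial
  gradient `G`, `C(r₀), D(r₀) < ∞`, and the absorption hypothesis
  `∀ ε > 0, ∃ F, ∀ r ∈ ]0, r₀], C(r) ≤ ε (E(r) + A(r)) + F`, there is `K < ∞` with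
  `A(r) + E(r) + C(r) + D(r) ≤ K` for all `0 < r < r₀/2`.

The proof is a transcription of `SereginSverak2009.ScaledEnergyBound.of_inputs`
(`SereginSverakScaledEnergy.lean`), with Seregin–Šverák's coordinate cylinders centred on the
axis replaced by the ball cylinders `parabolicCylinder r z` at the fixed vertex `z`:

* (as12) is the tree theorem `Seregin2020.localEnergyBound_top` (local energy bound for cylinders
  touching the top of the domain), its term `D^{2/3} C^{1/3}` being split by Young
  (`Seregin2020.rpow_two_thirds_mul_rpow_one_third_le` with `s = 1`);
* (as13) is the tree theorem `seregin_sverak_pressure_decay_holds` (through `.ratio`);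
* (as11) is the hypothesis `habs`;
* the elementary scheme is the abstract one of `SereginSverakIteration.lean`
  (`SereginSverak2009.decay_step_half`, `iterate_halving`, `exists_ratio`, `exists_parameter`),
  run on the reparametrised radii `r = 2 r₀ s`, `s ∈ ]0, 1/4[`; the top scales
  `s ∈ [ϑ/4, 1/4[` are controlled by `A(r₀/2) + E(r₀/2) < ∞` (again `localEnergyBound_top`, from
  `C(r₀), D(r₀) < ∞`) and `D(r₀) < ∞` through the monotonicity of the functionals in the cylinder
  (`cknAEss_le_mul_of_subset`, `cknE_le_mul_of_subset`, `cknD_le_mul_of_subset`,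
  `Seregin2020.cknC_le_mul_of_subset`).

It serves Seregin 2014, Prop. 3.11 (i) in the tree (`scaledEnergies_bounded_of_typeIRate`, where
the absorption hypothesis is produced from the Type I rate `√(t₀ - t) |u| ≤ c`). Nothing about
axial symmetry is used or stated here.

## References

* G. Seregin, V. Šverák, Comm. PDE 34 (2009), 171–201 = arXiv:0804.1803, §3, Lemma 3.5 and its
  proof, (as11)–(as13) and the displays following (as13) (pp. 9–10). [`SereginSverak2009`]
* G. Seregin, *Lecture Notes on Regularity Theory for the Navier–Stokes Equations*, World
  Scientific (2014), Prop. 3.11 (i), Lemmas 6.2–6.4. [`Seregin2014`]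
-/

noncomputable section

open MeasureTheory Set Function Filter Topology TopologicalSpace Metric
open scoped NNReal ENNReal

namespace Literature.Analysis.FluidPDE

/-- The constants of (as12): `c₁ C^{2/3} + c₂ C + c₃ D^{2/3} C^{1/3} ≤ K (C^{2/3} + C + D)` as soon
as `c₁, c₂ + c₃, c₃ ≤ K` (Young `D^{2/3} C^{1/3} ≤ D + C`). [folklore] -/
theorem cubicAbsorptionBound_localEnergy_rhs_le {c₁ c₂ c₃ K : ℝ≥0} (h₁ : c₁ ≤ K)
    (h₂ : c₂ + c₃ ≤ K) (h₃ : c₃ ≤ K) (C D : ℝ≥0∞) :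
    (c₁ : ℝ≥0∞) * C ^ (2 / 3 : ℝ) + c₂ * C + c₃ * (D ^ (2 / 3 : ℝ) * C ^ (1 / 3 : ℝ)) ≤
      K * (C ^ (2 / 3 : ℝ) + C + D) := by
  have hY := Seregin2020.rpow_two_thirds_mul_rpow_one_third_le D C one_ne_zero ENNReal.one_ne_top
  rw [one_mul, inv_one, one_pow, one_mul] at hY
  have h₁' : (c₁ : ℝ≥0∞) ≤ K := ENNReal.coe_le_coe.2 h₁
  have h₂' : (c₂ : ℝ≥0∞) + c₃ ≤ K := by exact_mod_cast h₂
  have h₃' : (c₃ : ℝ≥0∞) ≤ K := ENNReal.coe_le_coe.2 h₃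
  calc (c₁ : ℝ≥0∞) * C ^ (2 / 3 : ℝ) + c₂ * C + c₃ * (D ^ (2 / 3 : ℝ) * C ^ (1 / 3 : ℝ))
      ≤ c₁ * C ^ (2 / 3 : ℝ) + c₂ * C + c₃ * (D + C) := by gcongr
    _ = c₁ * C ^ (2 / 3 : ℝ) + (c₂ + c₃) * C + c₃ * D := by ring
    _ ≤ K * C ^ (2 / 3 : ℝ) + K * C + K * D := by gcongr
    _ = K * (C ^ (2 / 3 : ℝ) + C + D) := by ring

/-- The ratio `κ⁻²` of the scaling of `C`: `(ofReal κ⁻¹)² = κ⁻²` in `ℝ≥0∞`. [folklore] -/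
theorem cubicAbsorptionBound_ofReal_inv_sq (κ : ℝ≥0) :
    ENNReal.ofReal ((κ : ℝ)⁻¹) ^ 2 = ((κ⁻¹ ^ 2 : ℝ≥0) : ℝ≥0∞) := by
  rw [← NNReal.coe_inv, ENNReal.ofReal_coe_nnreal, ENNReal.coe_pow]

/-- The ratio `κ⁻²` of (as13): `ofReal (κ⁻¹ ^ 2) = κ⁻²` in `ℝ≥0∞`. [folklore] -/
theorem cubicAbsorptionBound_ofReal_inv_sq' (κ : ℝ≥0) :
    ENNReal.ofReal ((κ : ℝ)⁻¹ ^ 2) = ((κ⁻¹ ^ 2 : ℝ≥0) : ℝ≥0∞) := by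
  rw [← NNReal.coe_inv, ← NNReal.coe_pow, ENNReal.ofReal_coe_nnreal]

/-- **Seregin–Šverák 2009, Lemma 3.5, the iteration in ball form for a general suitable weak
solution** (= Seregin 2014, Prop. 3.11 (i), once the absorption is granted). Let `(u, p)` be a
suitable weak solution of the unforced Navier–Stokes equations (`ν = 1`) on an open
`Q ⊆ ℝ × ℝ³`, `G` a weak spatial gradient of `u` on `Q`, `Q_{r₀}(z) ⊆ Q` a backward cylinder
(possibly touching the top of `Q`) with `C(r₀; z), D(r₀; z) < ∞`, and assume the cubic
absorption (as11): for every `ε > 0` there is `F < ∞` with `C(r) ≤ ε (E(r) + A(r)) + F` for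
`0 < r ≤ r₀`. Then `A(r) + E(r) + C(r) + D(r) ≤ K < ∞` for all `0 < r < r₀/2`
(`A = cknAEss`, `E = cknE`, `C = cknC`, `D = cknD` at the vertex `z`). Proof: the printed
iteration (arXiv p. 10) — (as12) = `Seregin2020.localEnergyBound_top`, (as13) =
`seregin_sverak_pressure_decay_holds`, `ℰ(ϑr) ≤ ½ ℰ(r) + f₃` by
`SereginSverak2009.decay_step_half`, iterated by `SereginSverak2009.iterate_halving` from the top
scales, where `ℰ` is bounded by monotonicity from `A(r₀/2) + E(r₀/2) + D(r₀) < ∞`; finally (as11)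
bounds `C`.
[cite: SereginSverak2009, proof of Lemma 3.5 (arXiv:0804.1803 pp. 9–10); Seregin2014 Prop. 3.11 (i)] -/
theorem scaledEnergies_bounded_of_cubicAbsorption {Q : Opens (ℝ × EuclideanSpace ℝ (Fin 3))}
    {u : ℝ → EuclideanSpace ℝ (Fin 3) → EuclideanSpace ℝ (Fin 3)} {p : ℝ → EuclideanSpace ℝ (Fin 3) → ℝ}
    {G : ℝ → EuclideanSpace ℝ (Fin 3) → EuclideanSpace ℝ (Fin 3) →L[ℝ] EuclideanSpace ℝ (Fin 3)}
    (hsw : IsSuitableWeakSolutionOn Q 1 0 u p) (hG : HasWeakSpatialGradientOn Q u G)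
    {z : ℝ × EuclideanSpace ℝ (Fin 3)} {r₀ : ℝ} (hr₀ : 0 < r₀)
    (hQ : parabolicCylinder r₀ z ⊆ (Q : Set (ℝ × EuclideanSpace ℝ (Fin 3))))
    (hC₀ : cknC r₀ z u ≠ ∞) (hD₀ : cknD r₀ z p ≠ ∞)
    (habs : ∀ ε : ℝ≥0, 0 < ε → ∃ F : ℝ≥0, ∀ r ∈ Ioc (0 : ℝ) r₀,
      cknC r z u ≤ ε * (cknE r z G + cknAEss r z u) + F) :
    ∃ K : ℝ≥0, ∀ r ∈ Ioo (0 : ℝ) (r₀ / 2),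
      cknAEss r z u + cknE r z G + cknC r z u + cknD r z p ≤ K := by
  -- ### the constants of (as12), (as13), and the parameters `ϑ`, `ε` (depending on them only)
  obtain ⟨c₁, c₂, c₃, HT⟩ := Seregin2020.localEnergyBound_top
  obtain ⟨c, hc⟩ := seregin_sverak_pressure_decay_holds.ratio
  set K : ℝ≥0 := max (c₁ + c₂ + c₃) c with hK
  have hK1 : c₁ ≤ K := (le_self_add.trans le_self_add).trans (le_max_left _ _)
  have hK2 : c₂ + c₃ ≤ K :=
    ((le_add_self).trans_eq (add_assoc c₁ c₂ c₃).symm).trans (le_max_left _ _)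
  have hK3 : c₃ ≤ K := (le_add_self).trans (le_max_left _ _)
  have hKc : (c : ℝ≥0∞) ≤ K := ENNReal.coe_le_coe.2 (le_max_right _ _)
  obtain ⟨ϑ, hϑ0, hϑ4, hKϑ⟩ := SereginSverak2009.exists_ratio (2 * K ^ 2 + K)
  obtain ⟨ε, hε0, hKε⟩ := SereginSverak2009.exists_parameter ((6 * K + K ^ 2) * (2 * ϑ)⁻¹ ^ 2)
  have hϑR : (0 : ℝ) < ϑ := by exact_mod_cast hϑ0
  have hϑR4 : 4 * (ϑ : ℝ) ≤ 1 := by exact_mod_cast hϑ4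
  have hϑ1R : (ϑ : ℝ) < 1 := by linarith
  -- `F = f₁(ε)` from the absorption hypothesis (as11)
  obtain ⟨F, hF⟩ := habs ε hε0
  -- ### reparametrisation `r = d s`, `d = 2 r₀`, `s ∈ ]0, 1/4[ ↔ r ∈ ]0, r₀/2[`
  set d : ℝ := 2 * r₀ with hd
  have hd0 : 0 < d := by positivity
  have hds : ∀ s ∈ Ioo (0 : ℝ) (1 / 4), 0 < d * s ∧ d * s < r₀ / 2 := fun s hs =>
    ⟨mul_pos hd0 hs.1, by rw [hd]; nlinarith [hs.2]⟩
  have hsubQ : ∀ s ∈ Ioo (0 : ℝ) (1 / 4),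
      parabolicCylinder (d * s) z ⊆ (Q : Set (ℝ × EuclideanSpace ℝ (Fin 3))) := fun s hs =>
    (parabolicCylinder_mono (hds s hs).1.le (by linarith [(hds s hs).2]) z).trans hQ
  -- (as11) on the reparametrised radii
  have h11 : ∀ s ∈ Ioo (0 : ℝ) (1 / 4),
      cknC (d * s) z u ≤ ε * (cknE (d * s) z G + cknAEss (d * s) z u) + F := fun s hs =>
    hF (d * s) ⟨(hds s hs).1, by linarith [(hds s hs).2]⟩
  -- (as12) on the reparametrised radii, from the local energy bound at the top
  have h12 : ∀ s ∈ Ioo (0 : ℝ) (1 / 4),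
      cknE (d * (s / 2)) z G + cknAEss (d * (s / 2)) z u ≤
        K * (cknC (d * s) z u ^ (2 / 3 : ℝ) + cknC (d * s) z u + cknD (d * s) z p) := by
    intro s hs
    have h := HT Q u p G hsw hG z (d * s) (hds s hs).1 (hsubQ s hs)
    rw [← mul_div_assoc, add_comm]
    exact h.trans (cubicAbsorptionBound_localEnergy_rhs_le hK1 hK2 hK3 _ _)
  -- (as13) on the reparametrised radii, from the pressure decay estimate
  have h13 : ∀ s ∈ Ioo (0 : ℝ) (1 / 4), ∀ κ : ℝ≥0, 0 < κ → κ ≤ 1 →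
      cknD (d * ((κ : ℝ) * s)) z p ≤
        K * (κ * cknD (d * s) z p + ((κ⁻¹ ^ 2 : ℝ≥0) : ℝ≥0∞) * cknC (d * s) z u) := by
    intro s hs κ hκ hκ1
    have hκR : (0 : ℝ) < κ := by exact_mod_cast hκ
    have hκ1R : (κ : ℝ) ≤ 1 := by exact_mod_cast hκ1
    have h := hc Q u p hsw.distributional z (d * s) κ (hds s hs).1 hκR hκ1R (hsubQ s hs)
    rw [ENNReal.ofReal_coe_nnreal, cubicAbsorptionBound_ofReal_inv_sq'] at h
    rw [show d * ((κ : ℝ) * s) = (κ : ℝ) * (d * s) by ring]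
    exact h.trans (by gcongr)
  -- the scaling of `C`
  have hC : ∀ s ∈ Ioo (0 : ℝ) (1 / 4), ∀ κ : ℝ≥0, 0 < κ → κ ≤ 1 →
      cknC (d * ((κ : ℝ) * s)) z u ≤ ((κ⁻¹ ^ 2 : ℝ≥0) : ℝ≥0∞) * cknC (d * s) z u := by
    intro s hs κ hκ hκ1
    have hκR : (0 : ℝ) < κ := by exact_mod_cast hκ
    have hκ1R : (κ : ℝ) ≤ 1 := by exact_mod_cast hκ1
    have hR := (hds s hs).1
    have hR' : 0 < (κ : ℝ) * (d * s) := mul_pos hκR hR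
    have hsub : parabolicCylinder ((κ : ℝ) * (d * s)) z ⊆ parabolicCylinder (d * s) z :=
      parabolicCylinder_mono hR'.le (mul_le_of_le_one_left hR.le hκ1R) z
    have h := Seregin2020.cknC_le_mul_of_subset hR hR' hsub u
    rw [div_mul_cancel_right₀ hR.ne' (κ : ℝ), cubicAbsorptionBound_ofReal_inv_sq] at h
    rwa [show d * ((κ : ℝ) * s) = (κ : ℝ) * (d * s) by ring]
  -- ### the top scales: `ℰ ≤ M < ∞` for `s ∈ [ϑ/4, 1/4[`, i.e. `r ∈ [ϑ r₀/2, r₀/2[`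
  set M : ℝ≥0∞ := ENNReal.ofReal ((ϑ : ℝ)⁻¹) * (cknAEss (r₀ / 2) z u + cknE (r₀ / 2) z G) +
    ENNReal.ofReal (2 * (ϑ : ℝ)⁻¹) ^ 2 * cknD r₀ z p with hM
  have hAEtop : cknAEss (r₀ / 2) z u + cknE (r₀ / 2) z G ≠ ∞ := by
    refine ne_top_of_le_ne_top ?_ (HT Q u p G hsw hG z r₀ hr₀ hQ)
    have h1 : cknC r₀ z u ^ (2 / 3 : ℝ) ≠ ∞ := ENNReal.rpow_ne_top_of_nonneg (by norm_num) hC₀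
    have h2 : cknC r₀ z u ^ (1 / 3 : ℝ) ≠ ∞ := ENNReal.rpow_ne_top_of_nonneg (by norm_num) hC₀
    have h3 : cknD r₀ z p ^ (2 / 3 : ℝ) ≠ ∞ := ENNReal.rpow_ne_top_of_nonneg (by norm_num) hD₀
    exact ENNReal.add_ne_top.2 ⟨ENNReal.add_ne_top.2 ⟨ENNReal.mul_ne_top ENNReal.coe_ne_top h1,
      ENNReal.mul_ne_top ENNReal.coe_ne_top hC₀⟩,
      ENNReal.mul_ne_top ENNReal.coe_ne_top (ENNReal.mul_ne_top h3 h2)⟩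
  have hMtop : M ≠ ∞ :=
    ENNReal.add_ne_top.2 ⟨ENNReal.mul_ne_top ENNReal.ofReal_ne_top hAEtop,
      ENNReal.mul_ne_top (ENNReal.pow_ne_top ENNReal.ofReal_ne_top) hD₀⟩
  have htop : ∀ s, (ϑ : ℝ) * (1 / 4) ≤ s → s < 1 / 4 →
      cknE (d * s) z G + cknAEss (d * s) z u + cknD (d * s) z p ≤ M := by
    intro s h1 h2
    have hs0 : 0 < s := lt_of_lt_of_le (by positivity) h1
    obtain ⟨hR, hRhalf⟩ := hds s ⟨hs0, h2⟩
    have hRr₀ : d * s ≤ r₀ := by linarith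
    have hlow : r₀ * ϑ / 2 ≤ d * s := by rw [hd]; nlinarith
    have hratio1 : (r₀ / 2) / (d * s) ≤ (ϑ : ℝ)⁻¹ := by
      rw [div_le_iff₀ hR]
      calc r₀ / 2 = (ϑ : ℝ)⁻¹ * (r₀ * ϑ / 2) := by field_simp
        _ ≤ (ϑ : ℝ)⁻¹ * (d * s) := by gcongr
    have hratio2 : r₀ / (d * s) ≤ 2 * (ϑ : ℝ)⁻¹ := by
      rw [div_le_iff₀ hR]
      calc r₀ = 2 * (ϑ : ℝ)⁻¹ * (r₀ * ϑ / 2) := by field_simp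
        _ ≤ 2 * (ϑ : ℝ)⁻¹ * (d * s) := by gcongr
    have hsubH : parabolicCylinder (d * s) z ⊆ parabolicCylinder (r₀ / 2) z :=
      parabolicCylinder_mono hR.le hRhalf.le z
    have hsub0 : parabolicCylinder (d * s) z ⊆ parabolicCylinder r₀ z :=
      parabolicCylinder_mono hR.le hRr₀ z
    have hE : cknE (d * s) z G ≤ ENNReal.ofReal ((ϑ : ℝ)⁻¹) * cknE (r₀ / 2) z G :=
      (cknE_le_mul_of_subset (half_pos hr₀) hR hsubH G).trans (by gcongr)
    have hA : cknAEss (d * s) z u ≤ ENNReal.ofReal ((ϑ : ℝ)⁻¹) * cknAEss (r₀ / 2) z u := by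
      have hsq : (d * s) ^ 2 ≤ (r₀ / 2) ^ 2 := pow_le_pow_left₀ hR.le hRhalf.le 2
      have hI : Ioo (z.1 - (d * s) ^ 2) z.1 ⊆ Ioo (z.1 - (r₀ / 2) ^ 2) z.1 :=
        Ioo_subset_Ioo (by linarith) le_rfl
      have hB : ball z.2 (d * s) ⊆ ball z.2 (r₀ / 2) := ball_subset_ball hRhalf.le
      exact (cknAEss_le_mul_of_subset (half_pos hr₀) hR hI hB u).trans (by gcongr)
    have hD : cknD (d * s) z p ≤ ENNReal.ofReal (2 * (ϑ : ℝ)⁻¹) ^ 2 * cknD r₀ z p :=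
      (cknD_le_mul_of_subset hr₀ hR hsub0 p).trans (by gcongr)
    calc cknE (d * s) z G + cknAEss (d * s) z u + cknD (d * s) z p
        ≤ ENNReal.ofReal ((ϑ : ℝ)⁻¹) * cknE (r₀ / 2) z G +
          ENNReal.ofReal ((ϑ : ℝ)⁻¹) * cknAEss (r₀ / 2) z u +
          ENNReal.ofReal (2 * (ϑ : ℝ)⁻¹) ^ 2 * cknD r₀ z p := add_le_add (add_le_add hE hA) hD
      _ = M := by rw [hM]; ring
  -- ### the iteration: `ℰ ≤ M + 2B` on `]0, r₀/2[`
  set B : ℝ≥0 := (6 * K + K ^ 2) * (2 * ϑ)⁻¹ ^ 2 * F + K * (2 * ϑ)⁻¹ ^ 2 with hB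
  have hΦ : ∀ r ∈ Ioo (0 : ℝ) (r₀ / 2),
      cknE r z G + cknAEss r z u + cknD r z p ≤ M + 2 * B := by
    intro r hr
    have hs : r / d ∈ Ioo (0 : ℝ) (1 / 4) :=
      ⟨div_pos hr.1 hd0, by rw [div_lt_iff₀ hd0, hd]; linarith [hr.2]⟩
    have key := SereginSverak2009.iterate_halving
      (Φ := fun s => cknE (d * s) z G + cknAEss (d * s) z u + cknD (d * s) z p)
      (B := (B : ℝ≥0∞)) (M := M) (R := 1 / 4) hϑR hϑ1R (by positivity : (0 : ℝ) < ϑ * (1 / 4))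
      le_rfl ?_ htop hs.1 hs.2
    · have e : d * (r / d) = r := by field_simp
      simpa only [e] using key
    · -- the contraction `ℰ(ϑ s) ≤ ½ ℰ(s) + B`
      intro s hs0 hsR
      exact SereginSverak2009.decay_step_half (E := fun s => cknE (d * s) z G)
        (A := fun s => cknAEss (d * s) z u) (C := fun s => cknC (d * s) z u)
        (D := fun s => cknD (d * s) z p) hϑ0 hϑ4 hKϑ hKε h11 h12 h13 hC ⟨hs0, hsR⟩
  -- ### conclusion: `A + E + C + D ≤ (M + 2B) + (ε (M + 2B) + F)`
  have hT : M + 2 * B + (ε * (M + 2 * B) + F) ≠ ∞ := by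
    have hMB : M + 2 * B ≠ ∞ := ENNReal.add_ne_top.2 ⟨hMtop, by finiteness⟩
    exact ENNReal.add_ne_top.2 ⟨hMB, ENNReal.add_ne_top.2 ⟨ENNReal.mul_ne_top (by finiteness) hMB,
      by finiteness⟩⟩
  refine ⟨(M + 2 * B + (ε * (M + 2 * B) + F)).toNNReal, fun r hr => ?_⟩
  rw [ENNReal.coe_toNNReal hT]
  have h1 := hΦ r hr
  have h2 := hF r ⟨hr.1, by linarith [hr.2]⟩
  calc cknAEss r z u + cknE r z G + cknC r z u + cknD r z p
      = (cknE r z G + cknAEss r z u + cknD r z p) + cknC r z u := by ring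
    _ ≤ (M + 2 * B) + (ε * (cknE r z G + cknAEss r z u) + F) := add_le_add h1 h2
    _ ≤ (M + 2 * B) + (ε * (M + 2 * B) + F) := by
        have hEA : cknE r z G + cknAEss r z u ≤ M + 2 * B := le_self_add.trans h1
        gcongr (M + 2 * (B : ℝ≥0∞)) + ((ε : ℝ≥0∞) * ?_ + (F : ℝ≥0∞))

end Literature.Analysis.FluidPDE
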